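import Summits.ValiantsHypothesis.ValiantsHypothesis.Theorems.KPlusLogSqLawTropicalBLexCensus

/-!
# Route «KPlusLogSqLaw», crux `TropicalB` (stmt-ValiantsHypothesis-19771) — LEX-NT, part 5: the lexicographic DEFICIENCY grows with `K`:
# a lexicographic `(m, K)` cell (`m ≥ 4`, `K ≥ 4`) misses at least `K − 3` histograms

HONEST FRAMING.  Census corollary of the lex core law (`LexCore.lex_core_law`, seat val-sym-trop-p5 g14, 2026-08-28; cell `pub-symmetroid`,
`--supports stmt-ValiantsHypothesis-19771 --as helper`).  A finite-format statement about the UNSIGNED census (`n + 1 ≤ multichoose K m − (K − 3)`)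
— calibration of the lexicographic sector, not a bound of `TropicalB` shape; nothing here bears on `TropicalB` in its window, `WeakLifting`,
DoorA26 / DoorA34, `MatrixDescartes` (stmt-ValiantsHypothesis-18050) or VP ≠ VNP.

CONTENT.  With exponents sorted (`StrictMono d`) and super-increasing by the size (`d l < d l' → m·d l < d l'`), the `K − 3` histogram triples
`T_i = (c^m, b^{m−1} e, a^{m−2} c e)` with `(a, b, c, e) = (i, i+1, i+2, i+3)`, `i < K − 3`, are instances of `lex_census` and are PAIRWISE
DISJOINT (their members are separated by class counts), so a dominant chain misses at least one histogram of each: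
* `not_all_three` — the three core multisets of one triple are not all visited (the body of `lex_census`);
* `lex_census_deficiency` — **`n + 1 + (K − 3) ≤ multichoose K m`** for every unsigned chain of a lexicographic `(m, K)` design, `m ≥ 4`, `K ≥ 4`
  (`K = 4`: the fast-digit law `designRowD_fastDigit_four`; `(4,5)`: `n ≤ 67`; `(4,6)`: `n ≤ 122`).
[this cell]
-/

set_option linter.dupNamespace false
set_option autoImplicit false

namespace Summit.ValiantsHypothesis.ValiantsHypothesis.Theorems.KPlusLogSqLaw

namespace LexCore

open Summit.ValiantsHypothesis.ValiantsHypothesis.Theorems.MatrixDescartes.Negative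
open Summit.ValiantsHypothesis.ValiantsHypothesis.Theorems.LacunarySymmetroidMatrixDescartes.TropicalCensus
open Finset

variable {m K : ℕ}

/-- **the three core multisets of one lex triple are not all visited** by a dominant chain (the body of `lex_census`). [this cell] -/
theorem not_all_three (hm : 4 ≤ m) (d : Fin K → ℕ) (v ε : Fin m → Fin m → Fin K → ℤ) (c₀ c₁ c₂ c₃ : Fin K)
    (h01 : d c₀ < d c₁) (h12 : d c₁ < d c₂) (h23 : d c₂ < d c₃)
    (hAB : (m : ℤ) * d c₂ < (m - 1 : ℤ) * d c₁ + d c₃) (hBC : (m - 1 : ℤ) * d c₁ + d c₃ < (m - 2 : ℤ) * d c₀ + d c₂ + d c₃)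
    {n : ℕ} (θ : Fin (n + 1) → ℤ) (p : Fin (n + 1) → Equiv.Perm (Fin m) × (Fin m → Fin K))
    (hθ : StrictMono θ) (hdom : ∀ k, IsDominant d v ε (θ k) (p k)) (hne : ∀ k : Fin n, p k.castSucc ≠ p k.succ)
    {kA kB kC : Fin (n + 1)} (hkA : (classSym (p kA) : Multiset (Fin K)) = Multiset.replicate m c₂)
    (hkB : (classSym (p kB) : Multiset (Fin K)) = c₃ ::ₘ Multiset.replicate (m - 1) c₁)
    (hkC : (classSym (p kC) : Multiset (Fin K)) = c₃ ::ₘ c₂ ::ₘ Multiset.replicate (m - 2) c₀) : False := by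
  classical
  have hsm := slope_strictMono_of_chainD d v ε θ p hθ hdom hne
  -- shapes
  have hlA : ∀ b, (p kA).2 b = c₂ := ParityLaw.const_of_classSym_replicate hkA
  obtain ⟨bs, hbs, hlB⟩ := ParityLaw.oneOff_of_classSym_cons (fun h => (ne_of_lt (h12.trans h23)) (by rw [h])) hkB
  obtain ⟨x, y, hxy, hx, hy, hlC⟩ := twoOff_of_classSym (c₀ := c₀) (c₂ := c₂) (c₃ := c₃)
    (fun h => (ne_of_lt (h01.trans h12)) (by rw [h])) (fun h => (ne_of_lt ((h01.trans h12).trans h23)) (by rw [h]))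
    (fun h => (ne_of_lt h23) (by rw [h])) hkC
  -- slopes of the three terms
  have slA : slope d (p kA) = (m : ℤ) * d c₂ := by
    rw [slope_eq_of_classSym, hkA, Multiset.map_replicate, Multiset.sum_replicate, nsmul_eq_mul]
  have slB : slope d (p kB) = (d c₃ : ℤ) + (m - 1 : ℤ) * d c₁ := by
    rw [slope_eq_of_classSym, hkB, Multiset.map_cons, Multiset.sum_cons, Multiset.map_replicate, Multiset.sum_replicate,
      nsmul_eq_mul]
    push_cast [Nat.cast_sub (by omega : 1 ≤ m)]
    ring
  have slC : slope d (p kC) = (d c₃ : ℤ) + d c₂ + (m - 2 : ℤ) * d c₀ := by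
    rw [slope_eq_of_classSym, hkC, Multiset.map_cons, Multiset.sum_cons, Multiset.map_cons, Multiset.sum_cons, Multiset.map_replicate,
      Multiset.sum_replicate, nsmul_eq_mul]
    push_cast [Nat.cast_sub (by omega : 2 ≤ m)]
    ring
  -- index order from slope order
  have hAB' : kA < kB := by
    have hs : slope d (p kA) < slope d (p kB) := by rw [slA, slB]; linarith
    exact hsm.lt_iff_lt.mp hs
  have hBC' : kB < kC := by
    have hs : slope d (p kB) < slope d (p kC) := by rw [slB, slC]; linarith
    exact hsm.lt_iff_lt.mp hs
  exact lex_core_law_chain hm d v ε c₀ c₁ c₂ c₃ h01 h12 h23.le θ p hθ hdom hAB' hBC' bs x y hxy hlA hlB hbs hlC hx hy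

/-- **THE LEXICOGRAPHIC DEFICIENCY GROWS WITH `K`.**  `m ≥ 4`, `K ≥ 4`, exponents sorted (`StrictMono d`) and super-increasing by the size
(`d l < d l' → m·d l < d l'`).  Every chain of unique optima at strictly increasing slopes with consecutive terms distinct satisfies
`n + 1 + (K − 3) ≤ multichoose K m`: it misses at least `K − 3` histograms (one in each of the pairwise disjoint triples
`((i+2)^m, (i+1)^{m−1}(i+3), i^{m−2}(i+2)(i+3))`, `i < K − 3`). [this cell] -/
theorem lex_census_deficiency (hm : 4 ≤ m) (hK : 4 ≤ K) (d : Fin K → ℕ) (hmono : StrictMono d)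
    (hsup : ∀ l l' : Fin K, d l < d l' → m * d l < d l') (v ε : Fin m → Fin m → Fin K → ℤ)
    {n : ℕ} (θ : Fin (n + 1) → ℤ) (p : Fin (n + 1) → Equiv.Perm (Fin m) × (Fin m → Fin K))
    (hθ : StrictMono θ) (hdom : ∀ k, IsDominant d v ε (θ k) (p k)) (hne : ∀ k : Fin n, p k.castSucc ≠ p k.succ) :
    n + 1 + (K - 3) ≤ Nat.multichoose K m := by
  classical
  -- the class multisets along the chain are pairwise distinct
  have hsm := slope_strictMono_of_chainD d v ε θ p hθ hdom hne
  set f : Fin (n + 1) → Sym (Fin K) m := fun k => classSym (p k) with hf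
  have hfinj : Function.Injective f := by
    intro k k' h
    apply hsm.injective
    simp only
    rw [slope_eq_of_classSym, slope_eq_of_classSym]
    exact congrArg (fun M : Sym (Fin K) m => ((M : Multiset (Fin K)).map fun l => (d l : ℤ)).sum) h
  -- the four classes of the `i`-th triple
  set ca : Fin (K - 3) → Fin K := fun i => ⟨i.val, by omega⟩ with hca
  set cb : Fin (K - 3) → Fin K := fun i => ⟨i.val + 1, by omega⟩ with hcb
  set cc : Fin (K - 3) → Fin K := fun i => ⟨i.val + 2, by omega⟩ with hcc
  set ce : Fin (K - 3) → Fin K := fun i => ⟨i.val + 3, by omega⟩ with hce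
  -- the three multisets of the `i`-th triple
  have cardA : ∀ i, Multiset.card (Multiset.replicate m (cc i)) = m := fun i => Multiset.card_replicate _ _
  have cardB : ∀ i, Multiset.card (ce i ::ₘ Multiset.replicate (m - 1) (cb i)) = m := fun i => by
    rw [Multiset.card_cons, Multiset.card_replicate]; omega
  have cardC : ∀ i, Multiset.card (ce i ::ₘ cc i ::ₘ Multiset.replicate (m - 2) (ca i)) = m := fun i => by
    rw [Multiset.card_cons, Multiset.card_cons, Multiset.card_replicate]; omega
  set MA : Fin (K - 3) → Sym (Fin K) m := fun i => ⟨Multiset.replicate m (cc i), cardA i⟩ with hMA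
  set MB : Fin (K - 3) → Sym (Fin K) m := fun i => ⟨ce i ::ₘ Multiset.replicate (m - 1) (cb i), cardB i⟩ with hMB
  set MC : Fin (K - 3) → Sym (Fin K) m := fun i => ⟨ce i ::ₘ cc i ::ₘ Multiset.replicate (m - 2) (ca i), cardC i⟩ with hMC
  have MAval : ∀ i, (MA i : Multiset (Fin K)) = Multiset.replicate m (cc i) := fun i => rfl
  have MBval : ∀ i, (MB i : Multiset (Fin K)) = ce i ::ₘ Multiset.replicate (m - 1) (cb i) := fun i => rfl
  have MCval : ∀ i, (MC i : Multiset (Fin K)) = ce i ::ₘ cc i ::ₘ Multiset.replicate (m - 2) (ca i) := fun i => rfl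
  -- class counts separate all these multisets
  have cntA : ∀ i (l : Fin K), Multiset.count l (MA i : Multiset (Fin K)) = if cc i = l then m else 0 := by
    intro i l; rw [MAval, Multiset.count_replicate]
  have cntB : ∀ i (l : Fin K), Multiset.count l (MB i : Multiset (Fin K)) =
      (if cb i = l then m - 1 else 0) + (if l = ce i then 1 else 0) := by
    intro i l; rw [MBval, Multiset.count_cons, Multiset.count_replicate]
  have cntC : ∀ i (l : Fin K), Multiset.count l (MC i : Multiset (Fin K)) =
      (if ca i = l then m - 2 else 0) + (if l = cc i then 1 else 0) + (if l = ce i then 1 else 0) := by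
    intro i l; rw [MCval, Multiset.count_cons, Multiset.count_cons, Multiset.count_replicate]
  -- the range of the chain
  set S : Finset (Sym (Fin K) m) := univ.image f with hS
  have hcardS : S.card = n + 1 := by rw [hS, Finset.card_image_of_injective _ hfinj, Finset.card_univ, Fintype.card_fin]
  have memS : ∀ M, M ∈ S ↔ ∃ k, f k = M := fun M => by simp [hS]
  -- each triple has an unvisited member
  have hmiss : ∀ i, ∃ M : Sym (Fin K) m, (M = MA i ∨ M = MB i ∨ M = MC i) ∧ M ∉ S := by
    intro i
    by_contra hall
    push Not at hall
    have hA := hall (MA i) (Or.inl rfl)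
    have hB := hall (MB i) (Or.inr (Or.inl rfl))
    have hC := hall (MC i) (Or.inr (Or.inr rfl))
    rw [memS] at hA hB hC
    obtain ⟨kA, hkA⟩ := hA
    obtain ⟨kB, hkB⟩ := hB
    obtain ⟨kC, hkC⟩ := hC
    have h01 : d (ca i) < d (cb i) := hmono (Fin.mk_lt_mk.mpr (by omega))
    have h12 : d (cb i) < d (cc i) := hmono (Fin.mk_lt_mk.mpr (by omega))
    have h23 : d (cc i) < d (ce i) := hmono (Fin.mk_lt_mk.mpr (by omega))
    have h3 : (m : ℤ) * d (cc i) < d (ce i) := by exact_mod_cast hsup _ _ h23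
    have h2 : (m : ℤ) * d (cb i) < d (cc i) := by exact_mod_cast hsup _ _ h12
    have hm' : (4 : ℤ) ≤ m := by exact_mod_cast hm
    refine not_all_three hm d v ε (ca i) (cb i) (cc i) (ce i) h01 h12 h23 ?_ ?_ θ p hθ hdom hne
      (kA := kA) (kB := kB) (kC := kC) ?_ ?_ ?_
    · nlinarith [Nat.cast_nonneg (α := ℤ) (d (cb i))]
    · nlinarith [Nat.cast_nonneg (α := ℤ) (d (ca i)), Nat.cast_nonneg (α := ℤ) (d (cb i))]
    · exact (congrArg Subtype.val hkA).trans (MAval i)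
    · exact (congrArg Subtype.val hkB).trans (MBval i)
    · exact (congrArg Subtype.val hkC).trans (MCval i)
  choose h hh hhS using hmiss
  -- the chosen members are pairwise distinct
  have hinj : Function.Injective h := by
    intro i j hij
    by_contra hne'
    have hv : i.val ≠ j.val := fun e => hne' (Fin.ext e)
    have key : ∀ l : Fin K, Multiset.count l (h i : Multiset (Fin K)) = Multiset.count l (h j : Multiset (Fin K)) := by
      intro l; rw [hij]
    rcases hh i with hi | hi | hi <;> rcases hh j with hj | hj | hj
    · have := key (cc i); rw [hi, hj, cntA, cntA] at this
      simp only [hcc, Fin.mk.injEq] at this; split_ifs at this <;> omega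
    · have := key (cc i); rw [hi, hj, cntA, cntB] at this
      simp only [hcc, hcb, hce, Fin.mk.injEq] at this; split_ifs at this <;> omega
    · have := key (cc i); rw [hi, hj, cntA, cntC] at this
      simp only [hcc, hca, hce, Fin.mk.injEq] at this; split_ifs at this <;> omega
    · have := key (cc j); rw [hi, hj, cntB, cntA] at this
      simp only [hcc, hcb, hce, Fin.mk.injEq] at this; split_ifs at this <;> omega
    · have := key (cb i); rw [hi, hj, cntB, cntB] at this
      simp only [hcb, hce, Fin.mk.injEq] at this; split_ifs at this <;> omega
    · have := key (cb i); rw [hi, hj, cntB, cntC] at this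
      simp only [hcb, hce, hca, hcc, Fin.mk.injEq] at this; split_ifs at this <;> omega
    · have := key (cc j); rw [hi, hj, cntC, cntA] at this
      simp only [hcc, hca, hce, Fin.mk.injEq] at this; split_ifs at this <;> omega
    · have := key (cb j); rw [hi, hj, cntC, cntB] at this
      simp only [hcb, hce, hca, hcc, Fin.mk.injEq] at this; split_ifs at this <;> omega
    · have := key (ca i); rw [hi, hj, cntC, cntC] at this
      simp only [hca, hcc, hce, Fin.mk.injEq] at this; split_ifs at this <;> omega
  -- counting: the range and the chosen members are disjoint subsets of `Sym (Fin K) m`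
  set Hs : Finset (Sym (Fin K) m) := univ.image h with hHs
  have hcardH : Hs.card = K - 3 := by rw [hHs, Finset.card_image_of_injective _ hinj, Finset.card_univ, Fintype.card_fin]
  have hdisj : Disjoint S Hs := by
    rw [Finset.disjoint_left]
    intro M hM hMH
    rw [hHs, Finset.mem_image] at hMH
    obtain ⟨i, -, hi⟩ := hMH
    exact hhS i (hi ▸ hM)
  have hle := Finset.card_le_univ (S ∪ Hs)
  rw [Finset.card_union_of_disjoint hdisj, hcardS, hcardH, Sym.card_sym_eq_multichoose, Fintype.card_fin] at hle
  exact hle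

/-- `DesignRowD` form of the deficiency law. [this cell] -/
theorem designRowD_lex_deficiency (hm : 4 ≤ m) (hK : 4 ≤ K) (d : Fin K → ℕ) (hmono : StrictMono d)
    (hsup : ∀ l l' : Fin K, d l < d l' → m * d l < d l') (v ε : Fin m → Fin m → Fin K → ℤ) :
    DesignRowD d v ε (Nat.multichoose K m - (K - 2)) := by
  intro n θ p hθ hdom hne
  have := lex_census_deficiency hm hK d hmono hsup v ε θ p hθ hdom hne
  omega

end LexCore

end Summit.ValiantsHypothesis.ValiantsHypothesis.Theorems.KPlusLogSqLaw
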